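import Literature.MathematicalPhysics.KineticTheory.LangevinChainConfined
import Literature.MathematicalPhysics.KineticTheory.ConfinedReach
import Literature.MathematicalPhysics.KineticTheory.LangevinChainLaSalle
import Literature.Probability.Process.SmallSets
import Literature.Probability.Process.InvariantUniqueness
import Mathlib.MeasureTheory.Integral.IntervalIntegral.FundThmCalculus
import HarnessLib

/-!
# Chains with confining potentials: LaSalle relaxation of the undriven chain, irreducibility towards the equilibrium, and uniqueness of the steady state from one local minorisation

Topic `Literature/MathematicalPhysics/KineticTheory` (trunk T-KINETIC). For an oscillator chain
`P` with confining potentials (`OscillatorChain.IsConfining`, `LangevinChainConfined.lean`) and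
its CONSTRUCTED transition semigroup `IsConfining.semigroup` (model-free pipeline), this file
proves the deterministic and the soft-probabilistic parts of the uniqueness of the invariant
measure, generalising `LangevinChainLaSalle.lean` / `LangevinChainReach.lean` (pinned chain, older
pipeline) to every confining chain with POSITIVE friction, INJECTIVE interaction force `V'` and a
potential whose ONLY CRITICAL POINT is the origin (e.g. the Hairer–Mattingly chain
`U = |q|^{2k}/2k`, `V = r²/2`):

* the undriven flow `φ_t(x) = drivenFlow (P.drift N) x 0 t` (zero noise path): cocycle, integral
  equation, differentiability, the energy identity `H(φ_t x) = H(x) - γ∫₀ᵗ ∑ w_i p_i²`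
  (`IsConfining.hamiltonian_freeFlow_eq`), monotonicity and convergence of the energy;
* **LaSalle** (`IsConfining.tendsto_freeFlow_zero`): `φ_t(x) → 0` for every `x` — at a cluster
  point `w` of the orbit the energy is stationary, so the dissipation vanishes along `φ(w)`, so the
  momentum of the last site vanishes identically, so `w = 0` by the rigidity
  `IsConfining.eq_zero_of_momentum_last_eq_zero` (peeling the chain from the right: `V'`
  injective; at the end a critical point of `Φ` with `p = 0`);
* **pointed irreducibility** (`IsConfining.langevinKernel_pos_of_mem_nhds_zero`): every
  neighbourhood of `0` is reached from every point with positive probability at all large times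
  (`ConfinedReach.lean`);
* **uniqueness from one local minorisation** (`IsConfining.invariant_unique_of_localSmall`): if
  the transition kernels admit ONE local minorisation near the equilibrium (an open `G₀ ∋ 0`, a
  measure `ν₀` charging every neighbourhood of some point, a time window on which
  `P_t(w, ·) ≥ ν₀` for `w ∈ G₀` — the printed content of CEHR 2018 Prop. 3.2/3.6, or of a
  Malliavin-type argument), then the semigroup has AT MOST ONE invariant probability measure:
  every compact set is small (`Literature/Probability/Process/SmallSets.lean`, pointed form, with
  the Feller property and the irreducibility above), the sublevel sets `{H ≤ n}` exhaust phase
  space, and `Literature.Probability.Process.invariant_unique_of_small_cover` applies.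

## References

* J. P. LaSalle, *Some extensions of Liapunov's second method*, IRE Trans. Circuit Theory **7**
  (1960) 520–527.
* N. Cuneo, J.-P. Eckmann, M. Hairer, L. Rey-Bellet, EJP **23** (2018) no. 55, Props. 3.3, 3.6,
  3.8 and §4.
* M. Hairer, J. C. Mattingly, Comm. Pure Appl. Math. **62** (2009), §1 ("the uniqueness of an
  invariant measure … follows quickly from the hypoellipticity of the generator and the
  Hamiltonian structure once the existence of an invariant measure is established").
* S. P. Meyn, R. L. Tweedie, *Markov Chains and Stochastic Stability* (1993), Thm 10.0.1.
-/

noncomputable section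

open MeasureTheory ProbabilityTheory Filter Topology Set Metric
open scoped NNReal ENNReal

namespace Literature.MathematicalPhysics.KineticTheory.HeatConduction

open Literature.MathematicalPhysics.KineticTheory Literature.Probability.Process
  Literature.Analysis.ODE

variable {N : ℕ}

namespace OscillatorChain

namespace IsConfining

variable {P : OscillatorChain}

/-! ### The undriven flow: basic properties -/

/-- For `t ≤ 0` the undriven flow is clamped at `x`. [folklore] -/
theorem freeFlow_of_nonpos (hP : P.IsConfining) (N : ℕ) (x : PhaseSpace N) {t : ℝ} (ht : t ≤ 0) :
    drivenFlow (P.drift N) x 0 t = x := by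
  rw [(hP.confinedDrift N).toConfinedDrift.flow_of_nonpos x continuous_zero ht]
  simp

/-- The undriven flow starts at `x`. [folklore] -/
theorem freeFlow_zero (hP : P.IsConfining) (N : ℕ) (x : PhaseSpace N) : drivenFlow (P.drift N) x 0 0 = x :=
  hP.freeFlow_of_nonpos N x le_rfl

/-- The zero path lies in the noise subspace. [folklore] -/
theorem zero_mem_noise (hP : P.IsConfining) (N : ℕ) (t : ℝ) : (0 : ℝ → PhaseSpace N) t ∈ (hP.confinedDrift N).noise :=
  (hP.confinedDrift N).noise.zero_mem

/-- **The cocycle property of the undriven flow**: `φ_{s+t} = φ_t ∘ φ_s` for `s, t ≥ 0`.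
[folklore] -/
theorem freeFlow_add (hP : P.IsConfining) (N : ℕ) (x : PhaseSpace N) {s t : ℝ} (hs : 0 ≤ s) (ht : 0 ≤ t) :
    drivenFlow (P.drift N) x 0 (s + t) = drivenFlow (P.drift N) (drivenFlow (P.drift N) x 0 s) 0 t := by
  have h := (hP.confinedDrift N).toConfinedDrift.flow_add x continuous_zero (hP.zero_mem_noise N) hs ht
  have e : (fun r : ℝ => (0 : ℝ → PhaseSpace N) (s + r) - (0 : ℝ → PhaseSpace N) s) = 0 := by
    funext r; simp
  rw [e] at h
  exact h

/-- The undriven flow is continuous in time. [folklore] -/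
theorem continuous_freeFlow (hP : P.IsConfining) (N : ℕ) (x : PhaseSpace N) : Continuous (drivenFlow (P.drift N) x 0) :=
  (hP.confinedDrift N).toConfinedDrift.continuous_flow x continuous_zero (hP.zero_mem_noise N)

/-- The undriven flow is continuous in the initial condition. [folklore] -/
theorem continuous_freeFlow_left (hP : P.IsConfining) (N : ℕ) (t : ℝ) : Continuous fun x : PhaseSpace N => drivenFlow (P.drift N) x 0 t :=
  (hP.confinedDrift N).toConfinedDrift.continuous_flow_left continuous_zero (hP.zero_mem_noise N) t

/-- The undriven flow solves the integral equation `z(t) = x + ∫₀ᵗ Y(z(s)) ds`, `t ≥ 0`.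
[folklore] -/
theorem freeFlow_eq_integral (hP : P.IsConfining) (N : ℕ) (x : PhaseSpace N) {t : ℝ} (ht : 0 ≤ t) :
    drivenFlow (P.drift N) x 0 t =
      x + ∫ s in (0 : ℝ)..t, P.drift N (drivenFlow (P.drift N) x 0 s) := by
  have h := (hP.confinedDrift N).toConfinedDrift.isIntegralSolutionOn_flow x continuous_zero
    (hP.zero_mem_noise N) t t ⟨ht, le_rfl⟩
  rw [h]
  simp

/-- The drift is continuous. [folklore] -/
theorem continuous_drift (hP : P.IsConfining) (N : ℕ) : Continuous (P.drift N) :=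
  (P.contDiff_one_drift hP.contDiff_U hP.contDiff_V N).continuous

/-- **The undriven flow is a classical solution**: `φ'(t) = Y(φ(t))` for `t > 0`. [folklore] -/
theorem hasDerivAt_freeFlow (hP : P.IsConfining) (N : ℕ) (x : PhaseSpace N) {t : ℝ} (ht : 0 < t) :
    HasDerivAt (drivenFlow (P.drift N) x 0) (P.drift N (drivenFlow (P.drift N) x 0 t)) t := by
  set z := drivenFlow (P.drift N) x 0 with hz
  have hYz : Continuous fun s => P.drift N (z s) := (hP.continuous_drift N).comp (hP.continuous_freeFlow N x)
  set g : ℝ → PhaseSpace N := fun s => x + ∫ r in (0 : ℝ)..s, P.drift N (z r) with hg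
  have hgd : HasDerivAt g (P.drift N (z t)) t := by
    have h1 := intervalIntegral.integral_hasDerivAt_right (hYz.intervalIntegrable 0 t)
      (hYz.stronglyMeasurableAtFilter volume (𝓝 t)) hYz.continuousAt
    exact h1.const_add x
  refine hgd.congr_of_eventuallyEq ?_
  filter_upwards [Icc_mem_nhds ht (lt_add_one t)] with s hs
  exact hP.freeFlow_eq_integral N x hs.1

/-! ### The energy identity and its consequences -/

/-- **The energy derivative along the undriven flow**: `(H∘φ)'(t) = -γ ∑ w_i p_i(t)²` (`t > 0`).
[cite: CuneoEckmannHairerReyBellet2018, §5 eq. (5.2)] -/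
theorem hasDerivAt_hamiltonian_freeFlow (hP : P.IsConfining) (N : ℕ) (x : PhaseSpace N) {t : ℝ} (ht : 0 < t) :
    HasDerivAt (fun s => P.hamiltonian N (drivenFlow (P.drift N) x 0 s))
      (-(P.γ * ∑ i, bathWeight N i * (drivenFlow (P.drift N) x 0 t).2 i ^ 2)) t := by
  have hH := hP.differentiable_hamiltonian N
  have h := ((hH _).hasFDerivAt).comp_hasDerivAt t (hP.hasDerivAt_freeFlow N x ht)
  rw [P.fderiv_hamiltonian_drift_self hH] at h
  exact h

/-- **The energy identity of the undriven flow**: `H(φ_t x) = H(x) - γ ∫₀ᵗ ∑_i w_i p_i(s)² ds`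
(`t ≥ 0`). [cite: CuneoEckmannHairerReyBellet2018, §5 eq. (5.2)] -/
theorem hamiltonian_freeFlow_eq (hP : P.IsConfining) (N : ℕ) (x : PhaseSpace N) {t : ℝ} (ht : 0 ≤ t) :
    P.hamiltonian N (drivenFlow (P.drift N) x 0 t) = P.hamiltonian N x -
      P.γ * ∫ s in (0 : ℝ)..t, ∑ i, bathWeight N i * (drivenFlow (P.drift N) x 0 s).2 i ^ 2 := by
  set z := drivenFlow (P.drift N) x 0 with hz
  have hzc : Continuous z := hP.continuous_freeFlow N x
  have hDc : Continuous fun s => ∑ i, bathWeight N i * (z s).2 i ^ 2 :=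
    continuous_finsetSum _ fun i _ =>
      continuous_const.mul (((continuous_apply i).comp (continuous_snd.comp hzc)).pow 2)
  have hf'c : Continuous fun s => -(P.γ * ∑ i, bathWeight N i * (z s).2 i ^ 2) :=
    (continuous_const.mul hDc).neg
  have hHc : Continuous fun s => P.hamiltonian N (z s) :=
    (P.continuous_hamiltonian hP.contDiff_U.continuous hP.contDiff_V.continuous N).comp hzc
  have hftc := intervalIntegral.integral_eq_sub_of_hasDeriv_right_of_le ht hHc.continuousOn
    (fun s hs => (hP.hasDerivAt_hamiltonian_freeFlow N x hs.1).hasDerivWithinAt)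
    (hf'c.intervalIntegrable 0 t)
  have hz0 : z 0 = x := hP.freeFlow_zero N x
  rw [intervalIntegral.integral_neg, intervalIntegral.integral_const_mul, hz0] at hftc
  linarith

/-- The dissipation integrand is nonnegative. [folklore] -/
theorem dissipationDensity_nonneg (N : ℕ) (y : PhaseSpace N) : 0 ≤ ∑ i, bathWeight N i * y.2 i ^ 2 :=
  Finset.sum_nonneg fun i _ => mul_nonneg (bathWeight_nonneg N i) (sq_nonneg _)

/-- The energy does not increase along the undriven flow: `H(φ_t x) ≤ H(x)` (all `t`). [folklore] -/
theorem hamiltonian_freeFlow_le (hP : P.IsConfining) (N : ℕ) (x : PhaseSpace N) (t : ℝ) :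
    P.hamiltonian N (drivenFlow (P.drift N) x 0 t) ≤ P.hamiltonian N x := by
  rcases le_or_gt t 0 with ht | ht
  · rw [hP.freeFlow_of_nonpos N x ht]
  · rw [hP.hamiltonian_freeFlow_eq N x ht.le]
    have h : 0 ≤ ∫ s in (0 : ℝ)..t, ∑ i, bathWeight N i * (drivenFlow (P.drift N) x 0 s).2 i ^ 2 :=
      intervalIntegral.integral_nonneg ht.le fun s _ => dissipationDensity_nonneg N _
    nlinarith [hP.γ_nonneg]

/-- The energy along the undriven flow is nonincreasing in time. [folklore] -/
theorem antitone_hamiltonian_freeFlow (hP : P.IsConfining) (N : ℕ) (x : PhaseSpace N) :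
    Antitone fun t => P.hamiltonian N (drivenFlow (P.drift N) x 0 t) := by
  intro a b hab
  simp only
  rcases le_or_gt a 0 with ha | ha
  · rw [hP.freeFlow_of_nonpos N x ha]
    exact hP.hamiltonian_freeFlow_le N x b
  · have h := hP.freeFlow_add N x ha.le (sub_nonneg.2 hab)
    rw [add_sub_cancel] at h
    rw [h]
    exact hP.hamiltonian_freeFlow_le N _ _

/-- The energy along the undriven flow converges as `t → ∞`. [folklore] -/
theorem exists_tendsto_hamiltonian_freeFlow (hP : P.IsConfining) (N : ℕ) (x : PhaseSpace N) :
    ∃ Einf : ℝ, Tendsto (fun t => P.hamiltonian N (drivenFlow (P.drift N) x 0 t)) atTop (𝓝 Einf) := by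
  refine ⟨_, tendsto_atTop_ciInf (hP.antitone_hamiltonian_freeFlow N x) ⟨0, ?_⟩⟩
  rintro _ ⟨t, rfl⟩
  exact hP.hamiltonian_nonneg N _

/-- The orbit of the undriven flow stays in the compact sublevel set `{H ≤ H(x)}`. [folklore] -/
theorem freeFlow_mem_sublevel (hP : P.IsConfining) (N : ℕ) (x : PhaseSpace N) (t : ℝ) :
    drivenFlow (P.drift N) x 0 t ∈ {y : PhaseSpace N | P.hamiltonian N y ≤ P.hamiltonian N x} :=
  hP.hamiltonian_freeFlow_le N x t

/-- **At a cluster point of the orbit the energy is stationary**: if `w` is a cluster point of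
`t ↦ φ_t(x)` at `+∞` then `H(φ_s w) = H(w)` for every `s ≥ 0`. [folklore] -/
theorem hamiltonian_freeFlow_eq_of_mapClusterPt (hP : P.IsConfining) (N : ℕ) (x : PhaseSpace N) {w : PhaseSpace N}
    (hw : MapClusterPt w atTop (drivenFlow (P.drift N) x 0)) {s : ℝ} (hs : 0 ≤ s) :
    P.hamiltonian N (drivenFlow (P.drift N) w 0 s) = P.hamiltonian N w := by
  obtain ⟨Einf, hE⟩ := hP.exists_tendsto_hamiltonian_freeFlow N x
  have hHc := P.continuous_hamiltonian hP.contDiff_U.continuous hP.contDiff_V.continuous N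
  have hcont : ∀ r : ℝ, Continuous fun y => P.hamiltonian N (drivenFlow (P.drift N) y 0 r) := fun r =>
    hHc.comp (hP.continuous_freeFlow_left N r)
  have hval : ∀ r : ℝ, 0 ≤ r → P.hamiltonian N (drivenFlow (P.drift N) w 0 r) = Einf := by
    intro r hr
    have hcl : MapClusterPt (P.hamiltonian N (drivenFlow (P.drift N) w 0 r)) atTop
        ((fun y => P.hamiltonian N (drivenFlow (P.drift N) y 0 r)) ∘ drivenFlow (P.drift N) x 0) :=
      MapClusterPt.continuousAt_comp (f := fun y => P.hamiltonian N (drivenFlow (P.drift N) y 0 r))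
        (hcont r).continuousAt hw
    have heq : ((fun y => P.hamiltonian N (drivenFlow (P.drift N) y 0 r)) ∘ drivenFlow (P.drift N) x 0)
        =ᶠ[atTop] fun t => P.hamiltonian N (drivenFlow (P.drift N) x 0 (t + r)) := by
      filter_upwards [eventually_ge_atTop 0] with t ht
      simp only [Function.comp_apply]
      rw [hP.freeFlow_add N x ht hr]
    have hlim : Tendsto (fun t => P.hamiltonian N (drivenFlow (P.drift N) x 0 (t + r))) atTop (𝓝 Einf) :=
      hE.comp (tendsto_atTop_add_const_right atTop r tendsto_id)
    exact t2_iff_nhds.1 inferInstance (((hcl.congrFun heq).clusterPt).mono hlim)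
  have h0 := hval 0 le_rfl
  rw [hP.freeFlow_zero N w] at h0
  rw [hval s hs, h0]

/-- **If the energy is stationary along the undriven flow and `γ > 0`, the bath momenta vanish
identically**: `p_i(s) = 0` for all `s ≥ 0` at every site with `w_i ≠ 0`. [folklore] -/
theorem momentum_eq_zero_of_hamiltonian_const (hP : P.IsConfining) (N : ℕ) (hγ : 0 < P.γ) (w : PhaseSpace N)
    (h : ∀ s, 0 ≤ s → P.hamiltonian N (drivenFlow (P.drift N) w 0 s) = P.hamiltonian N w)
    (i : Fin N) (hi : bathWeight N i ≠ 0) :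
    ∀ s, 0 ≤ s → (drivenFlow (P.drift N) w 0 s).2 i = 0 := by
  set D : ℝ → ℝ := fun r => ∑ j, bathWeight N j * (drivenFlow (P.drift N) w 0 r).2 j ^ 2 with hD
  have hzc := hP.continuous_freeFlow N w
  have hDc : Continuous D :=
    continuous_finsetSum _ fun j _ =>
      continuous_const.mul (((continuous_apply j).comp (continuous_snd.comp hzc)).pow 2)
  have hint : ∀ t, 0 ≤ t → ∫ s in (0 : ℝ)..t, D s = 0 := by
    intro t ht
    have h1 := hP.hamiltonian_freeFlow_eq N w ht
    rw [h t ht] at h1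
    have h2 : P.γ * ∫ s in (0 : ℝ)..t, D s = 0 := by linarith
    exact (mul_eq_zero.1 h2).resolve_left hγ.ne'
  have hD0 := eq_zero_of_intervalIntegral_eq_zero hDc hint
  intro s hs
  have hterm := (Finset.sum_eq_zero_iff_of_nonneg fun j _ =>
    mul_nonneg (bathWeight_nonneg N j) (sq_nonneg _)).1 (hD0 s hs) i (Finset.mem_univ i)
  rcases mul_eq_zero.1 hterm with h3 | h3
  · exact absurd h3 hi
  · exact pow_eq_zero_iff (n := 2) two_ne_zero |>.1 h3

/-! ### The component equations of the undriven flow -/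

/-- The drift in closed form: `Y(q, p) = (p, -∂Φ(q) - γ w p)`. [folklore] -/
theorem drift_apply (hP : P.IsConfining) (N : ℕ) (x : PhaseSpace N) :
    P.drift N x = (x.2, fun i => -P.dPotential N i x.1 - P.γ * bathWeight N i * x.2 i) := by
  rw [P.drift_eq hP.differentiable_U hP.differentiable_V N]

/-- **Position components of the integral equation**: `q_i(t) = q_i(0) + ∫₀ᵗ p_i`. [folklore] -/
theorem freeFlow_fst_eq (hP : P.IsConfining) (N : ℕ) (x : PhaseSpace N) (i : Fin N) {t : ℝ} (ht : 0 ≤ t) :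
    (drivenFlow (P.drift N) x 0 t).1 i =
      x.1 i + ∫ s in (0 : ℝ)..t, (drivenFlow (P.drift N) x 0 s).2 i := by
  set z := drivenFlow (P.drift N) x 0 with hz
  have hF : IntervalIntegrable (fun s => P.drift N (z s)) volume 0 t :=
    ((hP.continuous_drift N).comp (hP.continuous_freeFlow N x)).intervalIntegrable 0 t
  have h := hP.freeFlow_eq_integral N x ht
  have hcomp := ((ContinuousLinearMap.proj (R := ℝ) i).comp
    (ContinuousLinearMap.fst ℝ (Fin N → ℝ) (Fin N → ℝ))).intervalIntegral_comp_comm hF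
  have h1 : (z t).1 i = x.1 i + ((∫ s in (0 : ℝ)..t, P.drift N (z s)).1) i := by
    show (drivenFlow (P.drift N) x 0 t).1 i = _
    rw [h]
    rfl
  rw [h1]
  congr 1
  simp only [ContinuousLinearMap.coe_comp, ContinuousLinearMap.coe_fst', Function.comp_apply,
    ContinuousLinearMap.proj_apply] at hcomp
  rw [← hcomp]
  refine intervalIntegral.integral_congr fun s _ => ?_
  rw [hP.drift_apply N]

/-- **Momentum components of the integral equation**:
`p_i(t) = p_i(0) + ∫₀ᵗ (-∂_iΦ(q) - γ w_i p_i)`. [folklore] -/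
theorem freeFlow_snd_eq (hP : P.IsConfining) (N : ℕ) (x : PhaseSpace N) (i : Fin N) {t : ℝ} (ht : 0 ≤ t) :
    (drivenFlow (P.drift N) x 0 t).2 i =
      x.2 i + ∫ s in (0 : ℝ)..t,
        (-P.dPotential N i (drivenFlow (P.drift N) x 0 s).1 -
          P.γ * bathWeight N i * (drivenFlow (P.drift N) x 0 s).2 i) := by
  set z := drivenFlow (P.drift N) x 0 with hz
  have hF : IntervalIntegrable (fun s => P.drift N (z s)) volume 0 t :=
    ((hP.continuous_drift N).comp (hP.continuous_freeFlow N x)).intervalIntegrable 0 t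
  have h := hP.freeFlow_eq_integral N x ht
  have hcomp := ((ContinuousLinearMap.proj (R := ℝ) i).comp
    (ContinuousLinearMap.snd ℝ (Fin N → ℝ) (Fin N → ℝ))).intervalIntegral_comp_comm hF
  have h1 : (z t).2 i = x.2 i + ((∫ s in (0 : ℝ)..t, P.drift N (z s)).2) i := by
    show (drivenFlow (P.drift N) x 0 t).2 i = _
    rw [h]
    rfl
  rw [h1]
  congr 1
  simp only [ContinuousLinearMap.coe_comp, ContinuousLinearMap.coe_snd', Function.comp_apply,
    ContinuousLinearMap.proj_apply] at hcomp
  rw [← hcomp]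
  refine intervalIntegral.integral_congr fun s _ => ?_
  rw [hP.drift_apply N]

/-- Along the undriven flow, a momentum that vanishes identically freezes its position.
[folklore] -/
theorem freeFlow_fst_const_of_snd_eq_zero (hP : P.IsConfining) (N : ℕ) (x : PhaseSpace N) (i : Fin N)
    (hp : ∀ t, 0 ≤ t → (drivenFlow (P.drift N) x 0 t).2 i = 0) :
    ∀ t, 0 ≤ t → (drivenFlow (P.drift N) x 0 t).1 i = x.1 i := by
  intro t ht
  rw [hP.freeFlow_fst_eq N x i ht]
  have : ∫ s in (0 : ℝ)..t, (drivenFlow (P.drift N) x 0 s).2 i = ∫ _ in (0 : ℝ)..t, (0 : ℝ) := by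
    refine intervalIntegral.integral_congr fun s hs => ?_
    rw [uIcc_of_le ht] at hs
    exact hp s hs.1
  rw [this]
  simp

/-- Along the undriven flow, a momentum that vanishes identically makes the force on its site
vanish: `p_i ≡ 0 ⟹ ∂_iΦ(q(t)) = 0`. [folklore] -/
theorem dPotential_eq_zero_of_snd_eq_zero (hP : P.IsConfining) (N : ℕ) (x : PhaseSpace N) (i : Fin N)
    (hp : ∀ t, 0 ≤ t → (drivenFlow (P.drift N) x 0 t).2 i = 0) :
    ∀ t, 0 ≤ t → P.dPotential N i (drivenFlow (P.drift N) x 0 t).1 = 0 := by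
  have hzc := hP.continuous_freeFlow N x
  have h21 : (2 : WithTop ℕ∞) = 1 + 1 := by norm_num
  have hFc : Continuous fun s => P.dPotential N i (drivenFlow (P.drift N) x 0 s).1 :=
    (P.contDiff_dPotential_of_succ (h21 ▸ hP.contDiff_U) (h21 ▸ hP.contDiff_V) N i).continuous.comp
      (continuous_fst.comp hzc)
  have hx0 : x.2 i = 0 := by
    have h0 := hp 0 le_rfl
    rwa [hP.freeFlow_zero N x] at h0
  refine eq_zero_of_intervalIntegral_eq_zero hFc fun t ht => ?_
  have h1 := hP.freeFlow_snd_eq N x i ht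
  rw [hp t ht, hx0] at h1
  have h2 : ∫ s in (0 : ℝ)..t, (-P.dPotential N i (drivenFlow (P.drift N) x 0 s).1 -
      P.γ * bathWeight N i * (drivenFlow (P.drift N) x 0 s).2 i) =
      ∫ s in (0 : ℝ)..t, -P.dPotential N i (drivenFlow (P.drift N) x 0 s).1 := by
    refine intervalIntegral.integral_congr fun s hs => ?_
    rw [uIcc_of_le ht] at hs
    rw [hp s hs.1]
    ring
  rw [h2, intervalIntegral.integral_neg] at h1
  linarith

/-! ### Rigidity: a motionless right end freezes the whole chain at the origin -/

/-- **Rigidity**: for a confining chain with injective interaction force `V'` whose potential has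
the origin as its only critical point, if along the undriven flow started at `w` the momentum of
the last site vanishes for all times, then `w = 0` (`N ≥ 1`). Peeling from the right as in
`pinnedChain_eq_zero_of_momentum_last_eq_zero`. [cite: CuneoEckmannHairerReyBellet2018, Prop 3.3] -/
theorem eq_zero_of_momentum_last_eq_zero (hP : P.IsConfining) (N : ℕ) (hN : 0 < N) (hVinj : Function.Injective (deriv P.V))
    (hcrit : ∀ q : Fin N → ℝ, (∀ i, P.dPotential N i q = 0) → q = 0) (w : PhaseSpace N)
    (h : ∀ t, 0 ≤ t → (drivenFlow (P.drift N) w 0 t).2 ⟨N - 1, by omega⟩ = 0) :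
    w = 0 := by
  have hzc : Continuous (drivenFlow (P.drift N) w 0) := hP.continuous_freeFlow N w
  have hz0 : drivenFlow (P.drift N) w 0 0 = w := hP.freeFlow_zero N w
  -- peeling induction on the number `k` of frozen sites from the right
  have hpeel : ∀ k, k ≤ N → ∀ i : Fin N, N - k ≤ i.val →
      ∀ t, 0 ≤ t → (drivenFlow (P.drift N) w 0 t).2 i = 0 := by
    intro k
    induction k with
    | zero =>
      intro _ i hi
      exact absurd i.isLt (by omega)
    | succ k ih =>
      intro hk i hi
      by_cases hi' : N - k ≤ i.val
      · exact ih (by omega) i hi'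
      · have hieq : i.val = N - (k + 1) := by omega
        rcases Nat.eq_zero_or_pos k with hk0 | hkpos
        · subst hk0
          have hiN : i = ⟨N - 1, by omega⟩ := Fin.ext (by simpa using hieq)
          intro t ht
          rw [hiN]
          exact h t ht
        · have hi₁ : i.val + 1 < N := by omega
          have hp₁ : ∀ t, 0 ≤ t → (drivenFlow (P.drift N) w 0 t).2 ⟨i.val + 1, hi₁⟩ = 0 :=
            ih (by omega) ⟨i.val + 1, hi₁⟩ (by simp only; omega)
          have hq₁ := hP.freeFlow_fst_const_of_snd_eq_zero N w ⟨i.val + 1, hi₁⟩ hp₁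
          have hF₁ := hP.dPotential_eq_zero_of_snd_eq_zero N w ⟨i.val + 1, hi₁⟩ hp₁
          have hq₂ : ∀ (h2 : i.val + 1 + 1 < N) (t : ℝ), 0 ≤ t →
              (drivenFlow (P.drift N) w 0 t).1 ⟨i.val + 1 + 1, h2⟩ = w.1 ⟨i.val + 1 + 1, h2⟩ := fun h2 =>
            hP.freeFlow_fst_const_of_snd_eq_zero N w ⟨i.val + 1 + 1, h2⟩
              (ih (by omega) ⟨i.val + 1 + 1, h2⟩ (by simp only; omega))
          -- the interaction force on the bond `(i, i+1)` is frozen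
          have hV : ∀ t, 0 ≤ t →
              deriv P.V (w.1 ⟨i.val + 1, hi₁⟩ - (drivenFlow (P.drift N) w 0 t).1 i) =
                -deriv P.U (w.1 ⟨i.val + 1, hi₁⟩) +
                  (if h2 : i.val + 1 + 1 < N then
                    deriv P.V (w.1 ⟨i.val + 1 + 1, h2⟩ - w.1 ⟨i.val + 1, hi₁⟩) else 0) := by
            intro t ht
            have e := hF₁ t ht
            rw [P.dPotential_succ_eq N i hi₁, hq₁ t ht] at e
            by_cases h2 : i.val + 1 + 1 < N
            · rw [dif_pos h2, hq₂ h2 t ht] at e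
              rw [dif_pos h2]
              linarith
            · rw [dif_neg h2] at e
              rw [dif_neg h2]
              linarith
          -- hence `q_i` is frozen
          have hqi : ∀ t, 0 ≤ t → (drivenFlow (P.drift N) w 0 t).1 i = w.1 i := by
            intro t ht
            have e1 := hV t ht
            have e0 := hV 0 le_rfl
            rw [hz0] at e0
            have e2 := hVinj (e1.trans e0.symm)
            linarith
          -- hence `p_i ≡ 0`
          have hpc : Continuous fun s => (drivenFlow (P.drift N) w 0 s).2 i :=
            (continuous_apply i).comp (continuous_snd.comp hzc)
          refine eq_zero_of_intervalIntegral_eq_zero hpc fun t ht => ?_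
          have e := hP.freeFlow_fst_eq N w i ht
          rw [hqi t ht] at e
          linarith
  have hall : ∀ i : Fin N, ∀ t, 0 ≤ t → (drivenFlow (P.drift N) w 0 t).2 i = 0 :=
    fun i => hpeel N le_rfl i (by omega)
  have hp0 : w.2 = 0 := by
    funext i
    have := hall i 0 le_rfl
    rwa [hz0] at this
  have hq0 : w.1 = 0 := by
    refine hcrit w.1 fun i => ?_
    have := hP.dPotential_eq_zero_of_snd_eq_zero N w i (hall i) 0 le_rfl
    rwa [hz0] at this
  exact Prod.ext hq0 hp0

/-! ### LaSalle: the undriven chain relaxes to the origin -/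

/-- **LaSalle's invariance principle for a damped confining chain** (`γ > 0`, `N ≥ 1`, `V'`
injective, `0` the only critical point of the potential): every trajectory of the undriven chain
converges to the equilibrium `0`. The orbit lies in the compact set `{H ≤ H(x)}`; at a cluster
point `w ≠ 0` the energy would be stationary along `φ(w)`, so the momentum of the last (bath) site
would vanish identically, so `w = 0` by rigidity. [cite: CuneoEckmannHairerReyBellet2018, Prop 3.3] -/
theorem tendsto_freeFlow_zero (hP : P.IsConfining) (N : ℕ) (hγ : 0 < P.γ) (hN : 0 < N) (hVinj : Function.Injective (deriv P.V))
    (hcrit : ∀ q : Fin N → ℝ, (∀ i, P.dPotential N i q = 0) → q = 0) (x : PhaseSpace N) :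
    Tendsto (drivenFlow (P.drift N) x 0) atTop (𝓝 0) := by
  by_contra hnot
  obtain ⟨U, hU, hfreq⟩ := not_tendsto_iff_exists_frequently_notMem.1 hnot
  obtain ⟨V, hVU, hVopen, h0V⟩ := _root_.mem_nhds_iff.1 hU
  set K : Set (PhaseSpace N) := {y | P.hamiltonian N y ≤ P.hamiltonian N x} ∩ Vᶜ with hK
  have hKc : IsCompact K := (hP.isCompact_setOf_hamiltonian_le N _).inter_right hVopen.isClosed_compl
  have hfreqK : ∃ᶠ t in atTop, drivenFlow (P.drift N) x 0 t ∈ K := by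
    refine (hfreq.and_eventually (Eventually.of_forall fun t =>
      hP.freeFlow_mem_sublevel N x t)).mono fun t ht => ?_
    exact ⟨ht.2, fun hV => ht.1 (hVU hV)⟩
  obtain ⟨w, hwK, hw⟩ := hKc.exists_mapClusterPt_of_frequently hfreqK
  have hconst : ∀ s, 0 ≤ s → P.hamiltonian N (drivenFlow (P.drift N) w 0 s) = P.hamiltonian N w :=
    fun s hs => hP.hamiltonian_freeFlow_eq_of_mapClusterPt N x hw hs
  have hlast := hP.momentum_eq_zero_of_hamiltonian_const N hγ w hconst ⟨N - 1, by omega⟩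
    (bathWeight_last_ne_zero N hN)
  have hw0 : w = 0 := hP.eq_zero_of_momentum_last_eq_zero N hN hVinj hcrit w hlast
  exact hwK.2 (hw0 ▸ h0V)

/-! ### Pointed irreducibility of the transition kernels -/

/-- **Every neighbourhood of the equilibrium is reached with positive probability at all large
times**: for a confining chain as in `tendsto_freeFlow_zero`, every initial condition `z` and
every neighbourhood `G` of `0` there is `s₀` with `P_t(z, G) > 0` for all `t ≥ s₀`
(`ConfinedReach.lean`). [cite: CuneoEckmannHairerReyBellet2018, Prop 3.3] -/
theorem langevinKernel_pos_of_mem_nhds_zero (hP : P.IsConfining) (N : ℕ) (hγ : 0 < P.γ) (hN : 0 < N)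
    (hVinj : Function.Injective (deriv P.V))
    (hcrit : ∀ q : Fin N → ℝ, (∀ i, P.dPotential N i q = 0) → q = 0) (T_L T_R : ℝ)
    (z : PhaseSpace N) {G : Set (PhaseSpace N)} (hG : G ∈ 𝓝 (0 : PhaseSpace N)) :
    ∃ s₀ : ℝ≥0, ∀ t : ℝ≥0, s₀ ≤ t → 0 < P.langevinKernel N T_L T_R t z G :=
  (hP.confinedDrift N).toConfinedDrift.sdeKernel_pos_of_tendsto_flow (hP.bathVec_mem_noise N _ _)
    (hP.bathVec_mem_noise N _ _) z (hP.tendsto_freeFlow_zero N hγ hN hVinj hcrit z) hG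

/-- **Pointed irreducibility** (`∃ t` form, the hypothesis `h_irred` of
`Literature/Probability/Process/SmallSets.lean`): every open set containing `0` is reached from
every point with positive probability. [cite: CuneoEckmannHairerReyBellet2018, Prop 3.3] -/
theorem exists_langevinKernel_pos_of_zero_mem (hP : P.IsConfining) (N : ℕ) (hγ : 0 < P.γ) (hN : 0 < N)
    (hVinj : Function.Injective (deriv P.V))
    (hcrit : ∀ q : Fin N → ℝ, (∀ i, P.dPotential N i q = 0) → q = 0) (T_L T_R : ℝ)
    (z : PhaseSpace N) (U : Set (PhaseSpace N)) (hU : IsOpen U) (h0 : (0 : PhaseSpace N) ∈ U) :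
    ∃ t : ℝ≥0, 0 < P.langevinKernel N T_L T_R t z U := by
  obtain ⟨s₀, hs₀⟩ := hP.langevinKernel_pos_of_mem_nhds_zero N hγ hN hVinj hcrit T_L T_R z
    (hU.mem_nhds h0)
  exact ⟨s₀, hs₀ s₀ le_rfl⟩

/-! ### Uniqueness of the invariant probability measure from one local minorisation -/

/-- **At most one invariant probability measure from ONE local minorisation near the
equilibrium.** For a confining chain with `γ > 0`, `N ≥ 1`, `V'` injective, `0` the only critical
point of the potential, and bath temperatures `T_L, T_R ≥ 0`: if the transition kernels admit a
local small set at `0` — an open `G₀ ∋ 0`, a measure `ν₀` charging every neighbourhood of some point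
`y₀`, and a window `[t₀ - δ, t₀ + δ]` (`0 < δ ≤ t₀`) with `P_t(w, ·) ≥ ν₀` for `w ∈ G₀` and `t` in
the window (the printed content of CEHR 2018, Props. 3.2/3.6) — then the constructed semigroup
has at most one invariant probability measure. Proof: the semigroup is Feller and pointedly
irreducible towards `0`, so every compact set is small
(`MarkovSemigroup.exists_smul_le_of_isCompact_of_mem`); the compact sublevel sets `{H ≤ n}`
exhaust phase space; `invariant_unique_of_small_cover` concludes.
[cite: CuneoEckmannHairerReyBellet2018, Prop 3.6 and Prop 3.8] -/
theorem invariant_unique_of_localSmall (hP : P.IsConfining) (N : ℕ) (hγ : 0 < P.γ) (hN : 0 < N)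
    (hVinj : Function.Injective (deriv P.V))
    (hcrit : ∀ q : Fin N → ℝ, (∀ i, P.dPotential N i q = 0) → q = 0) {T_L T_R : ℝ}
    (hTL : 0 ≤ T_L) (hTR : 0 ≤ T_R)
    {G₀ : Set (PhaseSpace N)} (hG₀ : IsOpen G₀) (h0 : (0 : PhaseSpace N) ∈ G₀)
    {ν₀ : Measure (PhaseSpace N)} {y₀ : PhaseSpace N}
    (hy₀ : ∀ V : Set (PhaseSpace N), IsOpen V → y₀ ∈ V → 0 < ν₀ V)
    {t₀ δ : ℝ} (hδ : 0 < δ) (hδt : δ ≤ t₀)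
    (hloc : ∀ t : ℝ≥0, t₀ - δ ≤ (t : ℝ) → (t : ℝ) ≤ t₀ + δ → ∀ w ∈ G₀,
      ν₀ ≤ P.langevinKernel N T_L T_R t w)
    {μ ν : Measure (PhaseSpace N)} [IsProbabilityMeasure μ] [IsProbabilityMeasure ν]
    (hμ : (hP.semigroup N T_L T_R hN hTL hTR).IsInvariant μ)
    (hν : (hP.semigroup N T_L T_R hN hTL hTR).IsInvariant ν) : μ = ν := by
  set κ := P.langevinKernel N T_L T_R with hκ
  haveI : ∀ t, IsMarkovKernel (κ t) := fun t => hP.isMarkovKernel_langevinKernel N T_L T_R t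
  have h_add : ∀ s t : ℝ≥0, κ (s + t) = κ t ∘ₖ κ s := hP.langevinKernel_add N T_L T_R
  have h_feller : ∀ (t : ℝ≥0) (g : BoundedContinuousFunction (PhaseSpace N) ℝ),
      Continuous fun x => ∫ y, g y ∂(κ t x) := fun t g =>
    hP.continuous_integral_langevinKernel_bcf N T_L T_R t g
  have h_irred : ∀ (z : PhaseSpace N) (U : Set (PhaseSpace N)), IsOpen U → (0 : PhaseSpace N) ∈ U →
      ∃ t : ℝ≥0, 0 < κ t z U := fun z U hU hz =>
    hP.exists_langevinKernel_pos_of_zero_mem N hγ hN hVinj hcrit T_L T_R z U hU hz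
  -- the small cover by energy sublevel sets
  set C : ℕ → Set (PhaseSpace N) := fun n => {x | P.hamiltonian N x ≤ n} with hC
  have hCmono : Monotone C := fun m n hmn x hx => by
    have hx' : P.hamiltonian N x ≤ m := hx
    show P.hamiltonian N x ≤ n
    exact hx'.trans (by exact_mod_cast hmn)
  have hCcov : ⋃ n, C n = univ := by
    refine eq_univ_of_forall fun x => mem_iUnion.2 ⟨⌈P.hamiltonian N x⌉₊, ?_⟩
    show P.hamiltonian N x ≤ (⌈P.hamiltonian N x⌉₊ : ℕ)
    exact Nat.le_ceil _
  have hν₀ne : ν₀ univ ≠ 0 := (hy₀ univ isOpen_univ (mem_univ _)).ne'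
  have hsmall : ∀ n, ∃ t : ℝ≥0, ∃ m : Measure (PhaseSpace N), m ≠ 0 ∧ ∀ x ∈ C n, m ≤ κ t x := by
    intro n
    obtain ⟨t_C, ht_C⟩ := MarkovSemigroup.exists_smul_le_of_isCompact_of_mem κ h_add h_feller h_irred
      hG₀ h0 hy₀ hδ hδt hloc (hP.isCompact_setOf_hamiltonian_le N n)
    obtain ⟨ε, hε0, -, hε⟩ := ht_C t_C le_rfl
    refine ⟨t_C, ε • ν₀, fun h0m => ?_, hε⟩
    have : (ε • ν₀) univ = 0 := by rw [h0m]; rfl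
    rw [Measure.smul_apply, smul_eq_mul, mul_eq_zero] at this
    exact this.elim (fun h => hε0.ne' h) hν₀ne
  exact invariant_unique_of_small_cover κ C hCmono hCcov hsmall hμ hν

end IsConfining

end OscillatorChain

end Literature.MathematicalPhysics.KineticTheory.HeatConduction

end
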